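import Summits.QuantumFields.YangMills.Theorems.OneCertifiedCubeFiniteSizeCriterion
import HarnessLib

/-!
# `NonSimplyConnectedLatticeGap` — stub CMP of line `Sketch` v9: sup-influence bounds mean influence
# (stub `stub_meanBoxInfluence_le_of_boxInfluence` of crux stmt-QuantumFields-16405, route `ConvexGribovBody`)

At fixed `(G, ρ, β, A, L, S)` with `supp A ⊆ Λ_L = [−L,L]⁴ × (4 directions)` and `L + 1 ≤ S`: if the kernel means
`γ_{Λ_L}(A | η) = ∫ A dγ_{Λ_L}(· | η)` of the Wilson specification `ymSpecification ρ β Λ_L` vary by at most `δ` over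
ALL exterior data `η`, then their `L¹(μ_S)` oscillation around the torus mean `μ_S(A)` of the torus Wilson state
`μ_S = wilsonMeasure ρ β` on the torus `(2S+1)⁴` is at most `δ`.

Proof (template `FiniteSizeCriterion.abs_latticeConnectedCorr_le_of_influence`, Georgii 2011 §8.2): the cube `Λ_L`
together with `supp A` and its collar is based in `[−L−1, L+1]⁴`, of width `2L+3 ≤ 2S+1`, hence injects into the
torus; the far-factor DLR identity on the torus with far factor `1`
(`FiniteSizeCriterion.integral_torusLift_mul_eq_integral_ymSpecification_mul_of_measurable`) gives
`μ_S(A) = ∫ γ_{Λ_L}(A | Ũ) dμ_S(U)`; a bounded function all of whose values are within `δ` of each other is within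
`δ` of its mean (`FiniteSizeCriterion.abs_sub_integral_le_of_forall`); integrate over the probability measure `μ_S`.
-/

set_option autoImplicit false

noncomputable section

open MeasureTheory Filter
open Literature.Probability.LatticeModels
open Literature.MathematicalPhysics.QuantumLattice
open Literature.MathematicalPhysics.QuantumFieldTheory (GaugeConfig wilsonMeasure isProbabilityMeasure_wilsonMeasure
  measurable_torusLift isSpecification_ymSpecification_of_t2Space)

namespace Summit.QuantumFields.YangMills.Theorems.NonSimplyConnectedLatticeGap

/-- **Sup-influence bounds mean influence** (registered stub `stub_meanBoxInfluence_le_of_boxInfluence`, CMP, of the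
skeleton `Cruxes/NonSimplyConnectedLatticeGap/Lines/Sketch.lean` v9 of item stmt-QuantumFields-16405): if the kernel
means `γ_{Λ_L}(A | η)` vary by at most `δ` over all exterior data then their `L¹(μ_S)` oscillation around
`μ_S(A) = ∫ γ_{Λ_L}(A | Ũ) dμ_S` (DLR on the torus `(2S+1)⁴`, `S ≥ L + 1`, far factor `1`) is at most `δ`. -/
theorem stub_meanBoxInfluence_le_of_boxInfluence : ∀ (G : Type) [Group G] [TopologicalSpace G] [IsTopologicalGroup G] [CompactSpace G] [MeasurableSpace G] [BorelSpace G] [SecondCountableTopology G] [T2Space G] (N : ℕ) (ρ : G →* Matrix (Fin N) (Fin N) ℂ), Continuous ρ → ∀ (β : ℝ) (A : Literature.MathematicalPhysics.QuantumLattice.LocalGaugeObservable 4 G) (L S : ℕ), A.supp ⊆ ((Fintype.piFinset fun _ : Fin 4 => Finset.Icc (-((L : ℕ) : ℤ)) ((L : ℕ) : ℤ)) ×ˢ (Finset.univ : Finset (Fin 4))) → L + 1 ≤ S → ∀ δ : ℝ, (∀ η η' : Literature.MathematicalPhysics.QuantumLattice.LGConfig 4 G, |(∫ U, A.F U ∂(Literature.MathematicalPhysics.QuantumLattice.ymSpecification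 ρ β ((Fintype.piFinset fun _ : Fin 4 => Finset.Icc (-((L : ℕ) : ℤ)) ((L : ℕ) : ℤ)) ×ˢ (Finset.univ : Finset (Fin 4))) η)) - ∫ U, A.F U ∂(Literature.MathematicalPhysics.QuantumLattice.ymSpecification ρ β ((Fintype.piFinset fun _ : Fin 4 => Finset.Icc (-((L : ℕ) : ℤ)) ((L : ℕ) : ℤ)) ×ˢ (Finset.univ : Finset (Fin 4))) η')| ≤ δ) → ∫ V, |(∫ U, A.F U ∂(Literature.MathematicalPhysics.QuantumLattice.ymSpecification ρ β ((Fintype.piFinset fun _ : Fin 4 => Finset.Icc (-((L : ℕ) : ℤ)) ((L : ℕ) : ℤ)) ×ˢ (Finset.univ : Finset (Fin 4))) (Literature.MathematicalPhysics.QuantumLattice.torusLift (2 * S + 1) V))) - ∫ W, A.F (Literature.MathematicalPhysics.QuantumLattice.torusLift (2 * S + 1) W) ∂(Literature.MathematicalPhysics.QuantumFieldTheory.wilsonMeasure (d := 4) (L := 2 * S + 1) ρ β)| ∂(Literature.MathematicalPhysics.QuantumFieldTheory.wilsonMeasure (d := 4) (L := 2 * S + 1) ρ β) ≤ δ := by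
  intro G _ _ _ _ _ _ _ _ N ρ hρ β A L S hAsupp hLS δ hΔ
  classical
  haveI := isProbabilityMeasure_wilsonMeasure (d := 4) (L := 2 * S + 1) ρ hρ β
  have hγ := isSpecification_ymSpecification_of_t2Space (d := 4) ρ hρ β
  obtain ⟨CA, hCA⟩ := A.bounded
  have hLS' : (L : ℤ) + 1 ≤ S := by exact_mod_cast hLS
  -- the cube `Λ` of radius `L`
  obtain ⟨Λ, hΛ⟩ : ∃ Λ : Finset (ZdEdge 4), Λ = (Fintype.piFinset fun _ : Fin 4 =>
    Finset.Icc (-((L : ℕ) : ℤ)) ((L : ℕ) : ℤ)) ×ˢ (Finset.univ : Finset (Fin 4)) := ⟨_, rfl⟩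
  rw [← hΛ] at hAsupp hΔ ⊢
  have hmemΛ : ∀ e ∈ Λ, ∀ i, -(L : ℤ) ≤ e.1 i ∧ e.1 i ≤ L := by
    intro e he i
    rw [hΛ, Finset.mem_product, Fintype.mem_piFinset] at he
    exact Finset.mem_Icc.1 (he.1 i)
  -- (i) `Λ`, the support of `A` and the collar of `Λ` inject into the torus
  have hwide : ∀ e ∈ Λ ∪ A.supp ∪ (plaquettesTouching Λ).biUnion plaquetteEdges, ∀ i,
      -(L : ℤ) - 1 ≤ e.1 i ∧ e.1 i ≤ L + 1 := by
    intro e he i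
    simp only [Finset.mem_union] at he
    rcases he with (he | he) | he
    · have h := hmemΛ e he i
      constructor <;> linarith only [h.1, h.2]
    · have h := hmemΛ e (hAsupp he) i
      constructor <;> linarith only [h.1, h.2]
    · obtain ⟨e', he', hn'⟩ := exists_near_of_mem_collar he
      have h := hmemΛ e' he' i
      have h' := hn' i
      constructor <;> linarith only [h.1, h.2, h'.1, h'.2]
  have hinj : Set.InjOn (Torus.proj (2 * S + 1))
      ((Λ ∪ A.supp ∪ (plaquettesTouching Λ).biUnion plaquetteEdges).image Prod.fst :
        Set (Site 4)) := by
    refine (FiniteSizeCriterion.injOn_torusProj_of_width (M := 2 * S + 1) (lo := -(L : ℤ) - 1)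
      (hi := (L : ℤ) + 1) (by push_cast; linarith only [hLS'])).mono fun x hx => ?_
    obtain ⟨e, he, rfl⟩ := Finset.mem_image.1 (Finset.mem_coe.1 hx)
    exact hwide e he
  -- (ii) the kernel mean of `A` is measurable and bounded, also along the periodic lift
  have hgm : Measurable fun η : LGConfig 4 G => ∫ U, A.F U ∂(ymSpecification ρ β Λ η) :=
    DobrushinShlosman.measurable_windowAvg' hγ Λ A.measurable
  have hgl : Measurable fun V : GaugeConfig 4 (2 * S + 1) G =>
      ∫ U, A.F U ∂(ymSpecification ρ β Λ (torusLift (2 * S + 1) V)) :=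
    hgm.comp (measurable_torusLift (2 * S + 1))
  have hgb : ∀ V : GaugeConfig 4 (2 * S + 1) G,
      |∫ U, A.F U ∂(ymSpecification ρ β Λ (torusLift (2 * S + 1) V))| ≤ CA := fun V =>
    abs_integral_ymSpecification_le ρ hρ β Λ hCA _
  -- (iii) DLR on the torus with far factor `1`: the torus mean of `A` is the mean of the kernel means
  have h2 := FiniteSizeCriterion.integral_torusLift_mul_eq_integral_ymSpecification_mul_of_measurable
    ρ hρ β Λ A.measurable hCA A.isCylinder hinj (H := fun _ => (1 : ℝ)) measurable_const (D := 1)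
    (fun _ => by simp) (fun _ _ => rfl)
  simp only [mul_one] at h2
  rw [h2]
  -- (iv) the kernel mean is within `δ` of its torus average, pointwise; integrate
  have hosc : ∀ V : GaugeConfig 4 (2 * S + 1) G,
      |(∫ U, A.F U ∂(ymSpecification ρ β Λ (torusLift (2 * S + 1) V))) -
        ∫ W, (∫ U, A.F U ∂(ymSpecification ρ β Λ (torusLift (2 * S + 1) W)))
          ∂(wilsonMeasure (d := 4) (L := 2 * S + 1) ρ β)| ≤ δ := fun V =>
    FiniteSizeCriterion.abs_sub_integral_le_of_forall (wilsonMeasure (d := 4) (L := 2 * S + 1) ρ β)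
      hgl hgb (fun V V' => hΔ _ _) V
  refine (le_abs_self _).trans (abs_integral_le_of_abs_le fun V => ?_)
  exact (abs_abs _).trans_le (hosc V)

end Summit.QuantumFields.YangMills.Theorems.NonSimplyConnectedLatticeGap

end
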